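import Summits.ABC.StewartYu.PadicG3VbLinesK
import Summits.ABC.StewartYu.PadicG3SupplyHalfSharp
import HarnessLib

/-!
# Cell abc-stewartyu, crux `Y07Odd` (stmt-ABC-19658), `m = 0` branch: the KUMMER HALF-STEP LINE of the inequality pack at `P.schedVb b`
# (sharp clearing `DCs`/`MhCs` of R22 (S1); far branch from `zerosV lev n ≥ 8·2ⁿ·Zp`, `Λ`-branch DIRECT per R23)

`Summits/ABC/StewartYu/PadicG3VbHalf.lean` — cell `abc-stewartyu` (seat p3-g7).  Theorems only, no named fact.  With `Th := ((17n+21)/2)·LgV`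
(the half-step order budget), `c_H := ŜG·log 2 + log 2 + (69/20)·HV + 2·log n`, the per-degree cost of the half-step threshold
`log 4 + 2·log DCs + log(1 + UcardS₂·PmaxS₂·MhCs) + 3·log heightProd` is `≤ log 4 + 3 log 2 + 2 lunkV + (AmaxS₂ bound) + Th·c_H + 8·htsV 0 + HV/e + AV⁺ + 3·Σ Aⱼ
≤ (7/2)·Zp` (`half_cost_le`), using p5's joint height charge `2·log halfDen + log halfHgtR ≤ 4|s₁|·Σ Lbⱼ h(αⱼ) ≤ 8·htsV 0`; hence
**`half_line_Vb`**: the hH conjunct of `IneqPackR₃` at `P.schedVb b` under `‖Λ/b_{j₀}‖ ≤ e^{−U}`, `8·2ⁿ·Zp + CondFloorV n ≤ U`.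

References: Yu. V. Nesterenko, LNM 1819 (2003) §4.3 (4.38)–(4.45); K. Yu, Acta Math. 211 (2013) §3.1.
-/

noncomputable section

open Finset Real
open Literature.NumberTheory.Transcendental
open Literature.NumberTheory.Transcendental.PadicCW77 (condExp)
open Literature.NumberTheory.Transcendental.CW77.Setup (Tau tauNorm)

namespace Summit.ABC.StewartYu

namespace PadicG3Par

variable {n : ℕ} (P : PadicG3Par n)

/-- `n + 1 ≤ Zp/2^35` (`Zp ≥ G·LgV·64(n+1)`, `G ≥ 16`, `LgV ≥ 2^25`). [folklore] -/
theorem succ_le_Zp : ((n : ℝ) + 1) ≤ P.Zp / 2 ^ 35 := by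
  obtain ⟨_, _, h⟩ := P.Zp_facts
  have hG := P.sixteen_le_G
  have hL : (2 : ℝ) ^ 25 ≤ P.LgV := by
    have h1 : 2 ^ 25 ≤ 2 ^ (n + 25) := Nat.pow_le_pow_right (by norm_num) (by omega)
    exact_mod_cast h1.trans P.two_pow_le_LgV
  have hGL : (2 : ℝ) ^ 29 ≤ P.G * P.LgV := by
    have : (2 : ℝ) ^ 29 = 16 * 2 ^ 25 := by norm_num
    rw [this]; exact mul_le_mul hG hL (by positivity) (by linarith)
  rw [le_div_iff₀ (by positivity)]
  have hn : (0 : ℝ) ≤ (n : ℝ) + 1 := by positivity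
  calc ((n : ℝ) + 1) * 2 ^ 35 = (2 : ℝ) ^ 29 * (64 * (n + 1)) := by ring
    _ ≤ P.G * P.LgV * (64 * (n + 1)) := mul_le_mul_of_nonneg_right hGL (by positivity)
    _ ≤ P.Zp := h

/-- at `m = 0` …: **`AV⁺ = L0V·(ŜG+n+6)·log 2 ≤ Zp/8`** (`L0V ≤ Zp/(28G) + 1`, `(ŜG+n+6) log 2 ≤ 2G + g + (3n+32) log 2 − 1`). [folklore] -/
theorem AVp_le' (hm : P.m = 0) (hθ : P.θ₀ = 1 / 2) (hNq : P.Nq = P.K) (hK₀ : (P.K₀ : ℝ) = P.p - 1) (hn2 : 2 ≤ n) :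
    (P.L0V : ℝ) * ((P.SdG + n + 6) * Real.log 2) ≤ P.Zp / 8 := by
  have hNqK : P.Nq ≤ 2 ^ n * P.K := by rw [hNq]; exact Nat.le_mul_of_pos_left _ (by positivity)
  have hS := P.SdG_log_le hm hθ hNqK
  have hL := P.L0V_le
  have hy := P.seven_G_le_yloadG hm hθ hNq hK₀
  have hG := P.sixteen_le_G
  have hGg := P.G_eq_mul_g
  have hg := P.one_le_g
  have hZ := P.Zp_facts.1
  obtain ⟨hGZ, _, _, _, _⟩ := P.tinyV
  have hl2 : Real.log 2 < 0.6931471808 := Real.log_two_lt_d9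
  have hl20 : 0 < Real.log 2 := Real.log_pos (by norm_num)
  have hypos := P.yloadG_pos
  -- `Z' := g XV LgV`, `Zp = G Z'`
  have hZ' : P.Zp = P.G * (P.g * P.XV * P.LgV) := rfl
  have hgXL : (0 : ℝ) < P.g * P.XV * P.LgV := by
    have := P.one_le_XV; have := P.one_le_LgV; positivity
  -- `L0V ≤ Z'/28 + 1`
  have hG0 : (0 : ℝ) < 28 * P.G := by linarith
  have h1 : (P.L0V : ℝ) ≤ (P.g * P.XV * P.LgV) / 28 + 1 := by
    have h := div_le_div_of_nonneg_left (by positivity : (0:ℝ) ≤ P.G * (P.g * P.XV * P.LgV)) hG0 (by linarith : 28 * P.G ≤ 4 * P.yloadG)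
    have e : P.G * (P.g * P.XV * P.LgV) / (28 * P.G) = (P.g * P.XV * P.LgV) / 28 := by field_simp
    rw [e] at h; linarith
  -- `(ŜG+n+6) log 2 ≤ (13/4)·G`
  have hn0 : (0 : ℝ) ≤ n := by positivity
  have hn : (2 : ℝ) ≤ n := by exact_mod_cast hn2
  have h2 : ((P.SdG : ℝ) + n + 6) * Real.log 2 ≤ (13 / 4) * P.G := by
    have hl3 : (3 * (n : ℝ) + 32) * Real.log 2 ≤ (3 * n + 32) * 0.6931471808 :=
      mul_le_mul_of_nonneg_left hl2.le (by positivity)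
    have h4 : (P.g - 1) + (3 * (n : ℝ) + 32) * Real.log 2 ≤ (5 / 4) * P.G := by
      rw [hGg]
      nlinarith [mul_nonneg (sub_nonneg.mpr hg) (by positivity : (0:ℝ) ≤ 10 * n + 9)]
    have hl6 : ((n : ℝ) + 6) * Real.log 2 ≤ (3 * n + 32) * Real.log 2 - (2 * n + 26) * Real.log 2 := by nlinarith
    nlinarith
  have hL0 : (0 : ℝ) ≤ P.L0V := by positivity
  have h3 : (P.L0V : ℝ) * ((P.SdG + n + 6) * Real.log 2) ≤ ((P.g * P.XV * P.LgV) / 28 + 1) * ((13 / 4) * P.G) :=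
    mul_le_mul h1 h2 (by positivity) (by positivity)
  refine h3.trans ?_
  rw [hZ'] at hGZ ⊢
  nlinarith [hGZ, hgXL]

/-- `3·Σⱼ Aⱼ ≤ Zp/500` (`Aⱼ ≤ Amax ≤ g·LgV/2`, `n·g·LgV ≤ Zp/(512(n+1))`). [folklore] -/
theorem three_sumA_le : 3 * ∑ j, P.A j ≤ P.Zp / 500 := by
  have hA := P.Amax_div_le_LgV
  have hg : 0 < P.g := lt_of_lt_of_le zero_lt_one P.one_le_g
  have hg1 := P.one_le_g
  have h1 : ∑ j, P.A j ≤ n * P.Amax := by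
    calc ∑ j, P.A j ≤ ∑ _j : Fin n, P.Amax := Finset.sum_le_sum fun j _ => P.hAmax j
      _ = n * P.Amax := by rw [Finset.sum_const, Finset.card_univ, Fintype.card_fin, nsmul_eq_mul]
  have h2 : 2 * P.Amax + 1 ≤ P.g * P.LgV := by rwa [div_le_iff₀' hg] at hA
  have hX := P.sixtyfour_le_XV'
  have hGg := P.G_eq_mul_g
  have hL : (0 : ℝ) ≤ P.LgV := by positivity
  have hn0 : (0 : ℝ) ≤ n := by positivity
  have hgL : (0 : ℝ) ≤ P.g * P.LgV := by positivity
  -- `3 Σ A ≤ (3/2) n g LgV`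
  have h3 : 3 * ∑ j, P.A j ≤ (3 / 2) * n * (P.g * P.LgV) := by nlinarith [mul_le_mul_of_nonneg_left h2 hn0]
  -- `750 n ≤ 8(n+1) g XV`
  have h4 : (750 : ℝ) * n ≤ 8 * (n + 1) * (P.g * P.XV) := by
    have hgX : 64 * ((n : ℝ) + 1) ≤ P.g * P.XV := by nlinarith [P.one_le_XV]
    nlinarith
  rw [le_div_iff₀ (by norm_num)]
  unfold Zp; rw [hGg]
  have e : 8 * ((n : ℝ) + 1) * P.g * (P.g * P.XV * P.LgV) = (8 * (n + 1) * (P.g * P.XV)) * (P.g * P.LgV) := by ring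
  rw [e]
  nlinarith [mul_le_mul_of_nonneg_right h4 hgL]

/-- `T₀ʳ·log 2 ≤ Zp/500` at `m = 0`, `n ≥ 2`. [folklore] -/
theorem T0r_log_two_le (hm : P.m = 0) (hθ : P.θ₀ = 1 / 2) (hNq : P.Nq = P.K) (hK₀ : (P.K₀ : ℝ) = P.p - 1) (hn2 : 2 ≤ n) :
    (69 / 4) * ((n : ℝ) + 1) * P.LgV * Real.log 2 ≤ P.Zp / 500 := by
  have h10 := P.succ_LgV_le hm hθ hNq hK₀
  have hZ := P.Zp_facts.1
  have hg := P.one_le_g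
  have hn : (2 : ℝ) ≤ n := by exact_mod_cast hn2
  have hl2 : Real.log 2 < 0.6931471808 := Real.log_two_lt_d9
  have hl20 : 0 < Real.log 2 := Real.log_pos (by norm_num)
  have hL : (0 : ℝ) ≤ ((n : ℝ) + 1) * P.LgV := by positivity
  have h1 : (69 / 4) * ((n : ℝ) + 1) * P.LgV * Real.log 2 ≤ 12 * (((n : ℝ) + 1) * P.LgV) := by nlinarith
  refine h1.trans ?_
  have h2 : 12 * (((n : ℝ) + 1) * P.LgV) ≤ 12 * (P.Zp / (2016 * (n + 1) * P.g)) := by linarith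
  refine h2.trans ?_
  rw [mul_div_assoc', div_le_div_iff₀ (by positivity) (by norm_num)]
  have h3 : (6000 : ℝ) ≤ 2016 * ((n : ℝ) + 1) * P.g := by nlinarith
  nlinarith [mul_le_mul_of_nonneg_left h3 hZ.le]

/-- **THE HALF-STEP PER-DEGREE COST IN THE UNIT `Zp`** (`m = 0`, `n ≥ 2`):
`log 4 + 3 log 2 + 2 lunkV + AMAX + Th·c_H + 8 htsV 0 + HV/e + AV⁺ + 3ΣAⱼ ≤ (7/2)·Zp`. [cite: Nesterenko2003, §4.3; shape only] -/
theorem half_cost_le (hm : P.m = 0) (hθ : P.θ₀ = 1 / 2) (hNq : P.Nq = P.K) (hK₀ : (P.K₀ : ℝ) = P.p - 1) (hn2 : 2 ≤ n) :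
    Real.log 4 + 3 * Real.log 2 + 2 * P.lunkV +
      (Real.log 2 + (69 / 4) * (n + 1) * P.LgV * (P.SdG * Real.log 2 + 43 / 20 * P.HV + 2 * Real.log n) + P.HV / Real.exp 1 +
        P.L0V * ((P.SdG + n + 6) * Real.log 2) + 2 * P.htsV 0) +
      (17 * n + 21) / 2 * P.LgV * (P.SdG * Real.log 2 + Real.log 2 + 69 / 20 * P.HV + 2 * Real.log n) +
      8 * P.htsV 0 + P.HV / Real.exp 1 + P.L0V * ((P.SdG + n + 6) * Real.log 2) + 3 * ∑ j, P.A j ≤ (7 / 2) * P.Zp := by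
  have hNqK : P.Nq ≤ 2 ^ n * P.K := by rw [hNq]; exact Nat.le_mul_of_pos_left _ (by positivity)
  have h2 := P.lunkV_le
  have h3 := P.T0r_SdG_le hm hθ hNq hK₀ hn2
  have h4 := P.T0r_HV_le
  have h5 := P.T0r_logn_le hm hθ hNq hK₀
  have h6 := P.HV_le_Zp
  have h7 := P.AVp_le' hm hθ hNq hK₀ hn2
  have h8 := P.htsV_le 0
  have h9 := P.three_sumA_le
  have h10 := P.succ_LgV_le hm hθ hNq hK₀
  have hZ := P.Zp_facts.1
  have hZ36 := P.Zp_ge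
  have hg := P.one_le_g
  have hn : (2 : ℝ) ≤ n := by exact_mod_cast hn2
  have hl2 : Real.log 2 < 0.6931471808 := Real.log_two_lt_d9
  have hl20 : 0 < Real.log 2 := Real.log_pos (by norm_num)
  have hl4 : Real.log 4 = 2 * Real.log 2 := by
    rw [show (4 : ℝ) = 2 ^ 2 by norm_num, Real.log_pow]; norm_num
  have he : 2 < Real.exp 1 := by have := Real.exp_one_gt_d9; linarith
  have hHV : (0 : ℝ) ≤ P.HV := by positivity
  have hHe : P.HV / Real.exp 1 ≤ P.HV / 2 := div_le_div_of_nonneg_left hHV (by norm_num) he.le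
  have hZg : P.Zp / P.g ≤ P.Zp := div_le_self hZ.le hg
  have hL : (0 : ℝ) ≤ P.LgV := by positivity
  have hlogn : (0 : ℝ) ≤ Real.log n := Real.log_nonneg (by linarith)
  have hSd : (0 : ℝ) ≤ P.SdG * Real.log 2 := by positivity
  simp only [pow_zero, one_mul] at h8
  -- `Th ≤ (8/15)·T0r`
  have hTh : (17 * (n : ℝ) + 21) / 2 * P.LgV ≤ (8 / 15) * ((69 / 4) * (n + 1) * P.LgV) := by nlinarith
  have hcH : (0 : ℝ) ≤ P.SdG * Real.log 2 + Real.log 2 + 69 / 20 * P.HV + 2 * Real.log n := by positivity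
  have hThc := mul_le_mul_of_nonneg_right hTh hcH
  -- `T0r·log 2 ≤ Zp/500`
  have hT0l := P.T0r_log_two_le hm hθ hNq hK₀ hn2
  have h36 : (2 : ℝ) ^ 36 = 68719476736 := by norm_num
  rw [h36] at hZ36
  have h4' : (69 / 4) * ((n : ℝ) + 1) * P.LgV * P.HV ≤ (69 / 256) * P.Zp := by nlinarith
  -- the `AmaxS₂` block
  have hA : Real.log 2 + (69 / 4) * (n + 1) * P.LgV * (P.SdG * Real.log 2 + 43 / 20 * P.HV + 2 * Real.log n) + P.HV / Real.exp 1 +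
      P.L0V * ((P.SdG + n + 6) * Real.log 2) + 2 * P.htsV 0 ≤ Real.log 2 + (6 / 5) * P.Zp := by
    have e : (69 / 4 : ℝ) * (n + 1) * P.LgV * (P.SdG * Real.log 2 + 43 / 20 * P.HV + 2 * Real.log n) =
        (69 / 4) * (n + 1) * P.LgV * (P.SdG * Real.log 2) + (43 / 20) * ((69 / 4) * (n + 1) * P.LgV * P.HV) +
        (69 / 4) * (n + 1) * P.LgV * (2 * Real.log n) := by ring
    rw [e]
    linarith
  -- the `Th·c_H` block
  have hB : (17 * n + 21) / 2 * P.LgV * (P.SdG * Real.log 2 + Real.log 2 + 69 / 20 * P.HV + 2 * Real.log n) ≤ (31 / 50) * P.Zp := by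
    have e : (8 / 15 : ℝ) * ((69 / 4) * (n + 1) * P.LgV) * (P.SdG * Real.log 2 + Real.log 2 + 69 / 20 * P.HV + 2 * Real.log n) =
        (8 / 15) * ((69 / 4) * (n + 1) * P.LgV * (P.SdG * Real.log 2) + (69 / 4) * (n + 1) * P.LgV * Real.log 2 +
          (69 / 20) * ((69 / 4) * (n + 1) * P.LgV * P.HV) + (69 / 4) * (n + 1) * P.LgV * (2 * Real.log n)) := by ring
    rw [e] at hThc
    linarith
  linarith

end PadicG3Par

end Summit.ABC.StewartYu

end
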